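import Summits.AtomisticToContinuum.FouriersLaw.Theorems.BondHeatUncertaintyBoundedResponseCorrectorCollapse
import Summits.AtomisticToContinuum.FouriersLaw.Theorems.BondHeatUncertaintyBoundedResponseBlockEnergyVariance
import Summits.AtomisticToContinuum.FouriersLaw.Theorems.BondHeatUncertaintyExtensiveSnapshotIrreversibilityOddCorrectorOfCorrectorGrade
import HarnessLib

/-!
(SPLIT FOR THE 400-LINE CAP by the landing lane, hand-2 g37: this file = part 1 of 3 (§1 parity algebra, §2 the sum rule); sequels `…ParitySectorSplitB` (§2b first moment of the boundary kernel, §3 graded sectors + the exact split) and `…ParitySectorSplit` (§4 doors) import it in a chain; the module docstring stays here; same namespace / section / opens / variables, all FQNs unchanged.)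
# BondHeatUncertainty / BoundedResponse — «ParitySectorSplit»: the residual leaf (C₁) `CorrectorGrade 1`
(≡ CCB(3) `CurrentCorrectorBudget 3`) is EXACTLY «even-sector scalar» ∧ «odd-sector grade», and the even scalar is the
FIRST MOMENT of the boundary kernel

Decomposition node `decomp-a2c-lens-1 / g101` (lens «grading / quantitative ladder»; critic row 1419 (B): the residual set
of record of the conjunct N_F `FouriersLaw` is {(D_F) `LeakPoint`, S1r′, CCB(3)}, with 11071 `BoundedResponse` ⟸ (D_F) ∧ CCB(3)
(door v6) and 9121 `ExtensiveSnapshotIrreversibility` ⟸ S1r′ ∧ CCB(3); (C₁) ⟺ KCB ⟺ CCB(3) are ONE leaf by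
`kineticCorrectorBudget_iff_correctorGrade_one` and `correctorGrade_one_iff_budget_three`).  This node GRADES that leaf by the
`ℤ/2`-character of momentum reversal `Θ(q,p) = (q,−p)`.

## The grading

`μ_T` is `Θ`-invariant, so for the Kubo corrector `h₀ = ∫_{(0,∞)} P_t(p₀² − T) dt ∈ L²(μ_T)` of the contact observable
(tree `kinCorrector`), with `h₀ = e + o` its `Θ`-even / `Θ`-odd parts,

  `‖h₀‖² = ⟨h₀∘Θ, h₀⟩ + ½·oddDefect(μ_T) h₀`,  `⟨h₀∘Θ, h₀⟩ = ‖e‖² − ‖o‖²`,  `½·oddDefect = 2‖o‖²`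

(`integral_flip_mul_eq`; parity algebra), and the even-sector scalar is a TRANSPORT COEFFICIENT — the SUM RULE

  `lim_{t→∞} Ov_N(t) = (γ/T²)·⟨h₀∘Θ, h₀⟩ = (γ/T²)·∫₀^∞ u·K_N(u) du`

(`tendsto_escapeTransient_atTop`, `tendsto_escapeTransient_atTop_moment`, `flip_pairing_eq_kernelMoment`) for the tree's escape
transient `Ov_N(t) = (γ/T²)∫ min(u,t) K_N(u) du = W_N(t) − t·E_N` (`escapeTransient`): by the tree's pairing formula
`Ov_N(t) = (γ/T²)⟨h₀∘Θ, h₀ − P_t h₀⟩` (`escapeTransient_eq_pairing`), `P_t h₀ → 0` pointwise under an `L¹(μ_T)` dominant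
(`tendsto_corrAct_atTop`, `abs_corrAct_le`: the tree's shift identity `act_kinCorrector_eq` + Harris package), and on the kernel
side dominated convergence under the exponential decay `|K_N(u)| ≤ D_N e^{−c_N u}` (`abs_escapeKernel_le_exp`).  So

  `‖h₀‖²_{μ_T} = ∫₀^∞ u·K_N(u) du + ½·oddDefect(μ_T) h₀`   (`correctorSq_eq_kernelMoment_add_oddDefect`):

the leaf's quantity is the kernel's FIRST moment (11071 itself is about the ZEROTH moment `∫₀^∞ K_N = (T²/γ)(1 − E_N)`) plus
the odd defect (the 9121 line's Fisher-information core).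

## Content (3 new `Prop`s, 0 other definitions; every object is the tree's)

* `EvenCorrectorGrade s` (Eᶜ_s) — `⟨h₀∘Θ, h₀⟩_{μ_T} ≤ C·N^s` eventually in `N` ⟺ `∫₀^∞ u·K_N(u) du ≤ C·N^s`
  (`evenCorrectorGrade_iff_kernelMoment`).
* `OddCorrectorGrade s` (Oᶜ_s) — `oddDefect(μ_T) h₀ ≤ C·N^s`; implies the tree's response-density grade `OddSnapshotGrade s`
  (`oddSnapshotGrade_of_oddCorrectorGrade`), and at `s = 1` is EXACTLY the `N`-uniform stub S4o `stub_oddCorrectorBound` of the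
  9121 line `clausius-budget-sound-window`: `∫ (w − w∘Θ)² dμ_T = (γ/T²)²·oddDefect(μ_T) h₀` for the McLennan corrector
  `w = (γ/2T²)(h₀ − h_{N−1})` (`oddCorrector_exact` — the energy coboundary `h₀ + h_{N−1} = (H − ⟨H⟩)/γ` is `Θ`-EVEN and
  drops out of `w − w∘Θ`; this sharpens node 99L's `≤ 4‖w‖²` to an identity), whence
  `oddCorrectorBound_of_oddCorrectorGrade_one : OddCorrectorGrade 1 → ⟨S4o verbatim⟩`, the converse
  `oddCorrectorGrade_one_of_oddCorrectorBound`, and `lateOddResponse_of_oddCorrectorGrade_one : OddCorrectorGrade 1 → ⟨S4 verbatim⟩`.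
* `TransientCeilingUniform s` (U^u_s) — `Ov_N(t) ≤ C·N^s` for all `t ≥ 0`, eventually in `N` (ceiling twin of the tree's
  `TransientFloorUniform s`); (C_s) ⟹ (U^u_s) ⟹ (Eᶜ_s) (`|Ov_N(t)| ≤ (2γ/T²)‖h₀‖²`, tree `abs_escapeTransient_le_correctorSq`;
  the sum rule), and (U^u₁) ⟹ (U) `TransientCeilingPoint`.
* ★ `correctorGrade_iff_even_odd (s) : CorrectorGrade s ↔ EvenCorrectorGrade s ∧ OddCorrectorGrade s` and
  ★ `correctorGrade_iff_parity (s) : CorrectorGrade s ↔ TransientCeilingUniform s ∧ OddCorrectorGrade s` (every grade `s`);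
  at `s = 1`: ★ `currentCorrectorBudget_three_iff_even_odd`, ★ `currentCorrectorBudget_three_iff_parity`.
* Doors: `boundedResponse_of_leakPoint_even_odd : LeakPoint → EvenCorrectorGrade 1 → OddCorrectorGrade 1 → BoundedResponse`
  (door v7 = door v6 with CCB(3) split; also `…_parity` with (U^u₁)), and the 9121 side above.

## What it says for the map (no item closes; an exact AND-split of the residual leaf CCB(3))

CCB(3) ⟺ (E₁ᶜ) ∧ (O₁ᶜ) ⟺ (U^u₁) ∧ (O₁ᶜ): both conjuncts WEAKER (each implied by CCB(3) by a displayed one-line bound),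
neither known to imply the other or CCB(3) — `‖e‖² − ‖o‖²` and `2‖o‖²` obey no common inequality; the generator couples the
sectors (`−A e = S o`, `−A o − S e = θ₀`, `A` = Liouville part, sector-swapping; `S` = Ornstein–Uhlenbeck part, sector-preserving,
acting on `p₀, p_{N−1}` only), and there is no Poincaré inequality for `S` on the bulk odd sector.  Residual sets after this node:
11071 ⟸ (D_F) ∧ (E₁ᶜ) ∧ (O₁ᶜ); 9121 ⟸ S1r′ ∧ (O₁ᶜ); the COMMON `N`-uniform leg of N_F is exactly the odd grade (O₁ᶜ) (= S4o);
the even scalar (E₁ᶜ) — a kernel-moment ceiling one moment above 11071 — is 11071-side only.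
Tags: (E₁ᶜ)/(U^u₁) WEAKER · even sector · scalar linear-response coefficient · INSTRUMENTABLE (first moment of the censused `K_N`;
`Ov_N = W_N − tE_N` from the step response) · harmonic-borderline (`∫uK^{harm} ≍ N`); (O₁ᶜ) WEAKER · odd sector · ⟺ S4o ·
UNDECIDED · phonon-TRUE (`oddDefect ≈ 0.32·N` in the response-density normalisation).

References: J. A. McLennan, Phys. Rev. 115 (1959) 1405 (the corrector); C. Maes, K. Netočný, J. Math. Phys. 51 (2010) 015219,
Thm 3.1 (McLennan ensembles; the `Θ`-odd response); A. Kundu, A. Dhar, O. Narayan, J. Stat. Mech. (2009) L03001, eqs. (2)–(3)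
(Green–Kubo formula for open boundary-driven chains: the conductance as a boundary-kernel integral); N. Cuneo, J.-P. Eckmann,
M. Hairer, L. Rey-Bellet, Electron. J. Probab. 23 (2018) no. 55, Thm 2.13 (Harris package).
-/

noncomputable section

open MeasureTheory ProbabilityTheory Filter Topology Set Function
open scoped NNReal ENNReal
open Literature.MathematicalPhysics.KineticTheory.HeatConduction
open Literature.MathematicalPhysics.KineticTheory OscillatorChain
open Summit.AtomisticToContinuum.FouriersLaw.Theorems.SubdiffusiveBondHeat
open Summit.AtomisticToContinuum.FouriersLaw.Theorems.OddSectorIrreversibility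
open Summit.AtomisticToContinuum.FouriersLaw.Theorems.BoundedResponse.TransientBand
open Summit.AtomisticToContinuum.FouriersLaw.Cruxes.SuperadditiveResistance.FloatingProbeBypassLaplacian
  (integral_flip_gibbsMeasure integrable_flip_gibbsMeasure measurePreserving_flip_gibbsMeasure)

namespace Summit.AtomisticToContinuum.FouriersLaw.Theorems.BoundedResponse.ParityFloor

open Summit.AtomisticToContinuum.FouriersLaw.Theses.BondHeatUncertainty (BoundedResponse)
open Summit.AtomisticToContinuum.FouriersLaw.Theorems.BoundedResponse.TransientBand (TransientCeilingPoint)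
open Summit.AtomisticToContinuum.FouriersLaw.Theorems.SubdiffusiveBondHeat.EscapeGrading (CurrentCorrectorBudget)

section ParitySectorSplit

variable {ω₂ lam β γ T : ℝ} {N : ℕ}

/-! ## §1 Parity algebra on `L²(μ_T)` (flip invariance of the Gibbs measure only) -/

/-- **`⟨f∘Θ, f⟩ = ‖f‖² − ½·oddDefect(μ_T) f`** for `f, f² ∈ L¹`-data over the `Θ`-invariant Gibbs measure
(`= ‖f^even‖² − ‖f^odd‖²`). [folklore] -/
theorem integral_flip_mul_eq (P : OscillatorChain) (N : ℕ) (T : ℝ) {f : PhaseSpace N → ℝ}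
    (hfm : StronglyMeasurable f) (hf2 : Integrable (fun z => f z ^ 2) (P.gibbsMeasure N T)) :
    ∫ z, f (z.1, -z.2) * f z ∂(P.gibbsMeasure N T) =
      (∫ z, f z ^ 2 ∂(P.gibbsMeasure N T)) - oddDefect (P.gibbsMeasure N T) f / 2 := by
  set μ := P.gibbsMeasure N T with hμ
  have hfm' : StronglyMeasurable fun z : PhaseSpace N => f (z.1, -z.2) :=
    hfm.comp_measurable (measurable_fst.prodMk measurable_snd.neg)
  have hf2' : Integrable (fun z : PhaseSpace N => f (z.1, -z.2) ^ 2) μ :=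
    integrable_flip_gibbsMeasure P N T (F := fun y => f y ^ 2) hf2
  have hflip : ∫ z, f (z.1, -z.2) ^ 2 ∂μ = ∫ z, f z ^ 2 ∂μ := integral_flip_gibbsMeasure P N T (fun y => f y ^ 2)
  have i1 : Integrable (fun z : PhaseSpace N => f (z.1, -z.2) * f z) μ :=
    integrable_mul_of_integrable_sq hfm'.aestronglyMeasurable hfm.aestronglyMeasurable hf2' hf2
  have e : (fun z : PhaseSpace N => (f z - f (z.1, -z.2)) ^ 2) =
      fun z => (f z ^ 2 + f (z.1, -z.2) ^ 2) - 2 * (f (z.1, -z.2) * f z) := by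
    funext z; ring
  have hs : Integrable (fun z : PhaseSpace N => f z ^ 2 + f (z.1, -z.2) ^ 2) μ := hf2.add hf2'
  have h2i : Integrable (fun z : PhaseSpace N => 2 * (f (z.1, -z.2) * f z)) μ := i1.const_mul 2
  unfold oddDefect
  rw [e, integral_sub hs h2i, integral_add hf2 hf2', integral_const_mul, hflip]
  ring

/-- **`oddDefect(μ_T) f ≤ 4‖f‖²`** (`(x − y)² ≤ 2x² + 2y²` and flip invariance). [folklore] -/
theorem oddDefect_le_four_mul (P : OscillatorChain) (N : ℕ) (T : ℝ) {f : PhaseSpace N → ℝ}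
    (hfm : StronglyMeasurable f) (hf2 : Integrable (fun z => f z ^ 2) (P.gibbsMeasure N T)) :
    oddDefect (P.gibbsMeasure N T) f ≤ 4 * ∫ z, f z ^ 2 ∂(P.gibbsMeasure N T) := by
  set μ := P.gibbsMeasure N T with hμ
  have hfm' : StronglyMeasurable fun z : PhaseSpace N => f (z.1, -z.2) :=
    hfm.comp_measurable (measurable_fst.prodMk measurable_snd.neg)
  have hf2' : Integrable (fun z : PhaseSpace N => f (z.1, -z.2) ^ 2) μ :=
    integrable_flip_gibbsMeasure P N T (F := fun y => f y ^ 2) hf2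
  have hflip : ∫ z, f (z.1, -z.2) ^ 2 ∂μ = ∫ z, f z ^ 2 ∂μ := integral_flip_gibbsMeasure P N T (fun y => f y ^ 2)
  have i1 : Integrable (fun z : PhaseSpace N => f (z.1, -z.2) * f z) μ :=
    integrable_mul_of_integrable_sq hfm'.aestronglyMeasurable hfm.aestronglyMeasurable hf2' hf2
  have hlow : -(∫ z, f z ^ 2 ∂μ) ≤ ∫ z, f (z.1, -z.2) * f z ∂μ := by
    have h1 : ∫ z, -((f z ^ 2 + f (z.1, -z.2) ^ 2) / 2) ∂μ ≤ ∫ z, f (z.1, -z.2) * f z ∂μ :=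
      integral_mono ((hf2.add hf2').div_const 2).neg i1 fun z => by
        dsimp only
        nlinarith [sq_nonneg (f z + f (z.1, -z.2))]
    rw [integral_neg, integral_div, integral_add hf2 hf2', hflip] at h1
    linarith
  rw [integral_flip_mul_eq P N T hfm hf2] at hlow
  linarith

/-! ## §2 The sum rule: `Ov_N(t) → (γ/T²)⟨h₀∘Θ, h₀⟩` as `t → ∞` -/

/-- **`|P_t h_b(z)| ≤ 2(K(2/ϑ+T)/c)·e^{ϑH(z)}` for every `t ≥ 0`** — the shift identity `P_t h_b = h_b − ∫₀ᵗ v_s ds`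
(tree `act_kinCorrector_eq`) and the tree bounds `abs_kinCorrector_le`, `abs_setIntegral_kinAct_le`. [folklore] -/
theorem abs_corrAct_le (hω : 0 < ω₂) (hl : 0 ≤ lam) (hβ : 0 < β) (hγ : 0 < γ) (hN : 0 < N) (hT : 0 < T)
    {ϑ K c : ℝ} (hϑ0 : 0 < ϑ) (h2ϑ : 2 * ϑ < 1 / T) (hK : 0 ≤ K)
    (hb : ∀ (z : PhaseSpace N) (t : ℝ≥0) (f : PhaseSpace N → ℝ), Continuous f → ∀ C : ℝ, 0 ≤ C →
      (∀ y, |f y| ≤ C * Real.exp (ϑ * (pinnedChain ω₂ lam β γ).hamiltonian N y)) →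
      |(∫ y, f y ∂((pinnedChain ω₂ lam β γ).transitionKernel N T T t z)) -
          ∫ y, f y ∂((pinnedChain ω₂ lam β γ).gibbsMeasure N T)| ≤
        K * C * Real.exp (ϑ * (pinnedChain ω₂ lam β γ).hamiltonian N z) * Real.exp (-c * t))
    (hc : 0 < c) (b : Fin N) {t : ℝ} (ht : 0 ≤ t) (z : PhaseSpace N) :
    |corrAct ω₂ lam β γ T N b t z| ≤
      2 * (K * (2 / ϑ + T) / c) * Real.exp (ϑ * (pinnedChain ω₂ lam β γ).hamiltonian N z) := by
  have h1 := act_kinCorrector_eq hω hl hβ hγ hN hT hϑ0 h2ϑ hK hb hc b ht z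
  have hh := abs_kinCorrector_le hω hl hβ hγ hT hϑ0 hb hc b z
  have hI := abs_setIntegral_kinAct_le hω hl hβ hγ hT hϑ0 hb hc b z t
  unfold corrAct
  rw [h1, intervalIntegral.integral_of_le ht]
  calc |kinCorrector ω₂ lam β γ T N b z - ∫ s in Ioc 0 t, kinAct ω₂ lam β γ T N b s z|
      ≤ |kinCorrector ω₂ lam β γ T N b z| + |∫ s in Ioc 0 t, kinAct ω₂ lam β γ T N b s z| :=
        abs_sub_le_abs_add_abs _ _
    _ ≤ _ := by linarith

/-- **`P_t h_b(z) → 0` as `t → ∞`**, for every `z` — `P_t h_b = h_b − ∫₀ᵗ v_s ds` and `∫₀ᵗ v_s ds → ∫_{(0,∞)} v_s ds = h_b`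
(absolute convergence of the Kubo integral, tree `kinAct_integrableOn`). [folklore] -/
theorem tendsto_corrAct_atTop (hω : 0 < ω₂) (hl : 0 ≤ lam) (hβ : 0 < β) (hγ : 0 < γ) (hN : 0 < N) (hT : 0 < T)
    {ϑ K c : ℝ} (hϑ0 : 0 < ϑ) (h2ϑ : 2 * ϑ < 1 / T) (hK : 0 ≤ K)
    (hb : ∀ (z : PhaseSpace N) (t : ℝ≥0) (f : PhaseSpace N → ℝ), Continuous f → ∀ C : ℝ, 0 ≤ C →
      (∀ y, |f y| ≤ C * Real.exp (ϑ * (pinnedChain ω₂ lam β γ).hamiltonian N y)) →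
      |(∫ y, f y ∂((pinnedChain ω₂ lam β γ).transitionKernel N T T t z)) -
          ∫ y, f y ∂((pinnedChain ω₂ lam β γ).gibbsMeasure N T)| ≤
        K * C * Real.exp (ϑ * (pinnedChain ω₂ lam β γ).hamiltonian N z) * Real.exp (-c * t))
    (hc : 0 < c) (b : Fin N) (z : PhaseSpace N) :
    Tendsto (fun t : ℝ => corrAct ω₂ lam β γ T N b t z) atTop (𝓝 0) := by
  have hI0 := (kinAct_integrableOn hω hl hβ hγ hT hϑ0 hb hc b z).1
  have hlim : Tendsto (fun t : ℝ => ∫ s in (0 : ℝ)..t, kinAct ω₂ lam β γ T N b s z) atTop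
      (𝓝 (∫ s in Ioi 0, kinAct ω₂ lam β γ T N b s z)) :=
    intervalIntegral_tendsto_integral_Ioi 0 hI0 tendsto_id
  have h2 : Tendsto (fun t : ℝ => kinCorrector ω₂ lam β γ T N b z - ∫ s in (0 : ℝ)..t, kinAct ω₂ lam β γ T N b s z)
      atTop (𝓝 (kinCorrector ω₂ lam β γ T N b z - ∫ s in Ioi 0, kinAct ω₂ lam β γ T N b s z)) :=
    tendsto_const_nhds.sub hlim
  have e0 : kinCorrector ω₂ lam β γ T N b z - ∫ s in Ioi 0, kinAct ω₂ lam β γ T N b s z = 0 := by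
    unfold kinCorrector; ring
  rw [e0] at h2
  refine h2.congr' ?_
  filter_upwards [eventually_ge_atTop (0 : ℝ)] with t ht
  unfold corrAct
  exact (act_kinCorrector_eq hω hl hβ hγ hN hT hϑ0 h2ϑ hK hb hc b ht z).symm

/-- ★ **SUM RULE `lim_{t→∞} Ov_N(t) = (γ/T²)·⟨h₀∘Θ, h₀⟩_{μ_T}`** (fixed `N ≥ 1`): the tree's pairing formula
`Ov_N(t) = (γ/T²)⟨h₀∘Θ, h₀ − P_t h₀⟩` (`escapeTransient_eq_pairing`), `P_t h₀ → 0` pointwise (`tendsto_corrAct_atTop`)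
under the `μ_T`-integrable dominant `|h₀∘Θ|·2(K(2/ϑ+T)/c)e^{ϑH}` (`abs_corrAct_le`, `ϑ = 1/(4T)`), dominated convergence.
[folklore] -/
theorem tendsto_escapeTransient_atTop (hω : 0 < ω₂) (hl : 0 < lam) (hβ : 0 < β) (hγ : 0 < γ) (hN : 0 < N) (hT : 0 < T) :
    Tendsto (escapeTransient ω₂ lam β γ T N) atTop
      (𝓝 (γ / T ^ 2 * ∫ z, kinCorrector ω₂ lam β γ T N ⟨0, hN⟩ (z.1, -z.2) * kinCorrector ω₂ lam β γ T N ⟨0, hN⟩ z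
        ∂((pinnedChain ω₂ lam β γ).gibbsMeasure N T))) := by
  set P := pinnedChain ω₂ lam β γ with hP
  obtain ⟨hϑ0, h2ϑ, hϑ1⟩ := weight_facts hT
  obtain ⟨K, c, hK, hc, hb⟩ := harrisBound_exists hω hl.le hβ hγ hN hT hϑ0 hϑ1
  obtain ⟨h0m, h02, h0m', h02'⟩ := corrector_sq_facts hω hl.le hβ hγ hN hT ⟨0, hN⟩
  set μT := P.gibbsMeasure N T with hμT
  set h0 : PhaseSpace N → ℝ := kinCorrector ω₂ lam β γ T N ⟨0, hN⟩ with hh0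
  set M : ℝ := 2 * (K * (2 / (1 / (4 * T)) + T) / c) with hM
  have hM0 : 0 ≤ M := by positivity
  have hν : Integrable (fun y => Real.exp (2 * (1 / (4 * T)) * P.hamiltonian N y)) μT :=
    pinnedChain_integrable_exp_mul_hamiltonian_gibbsMeasure hω hl.le hβ.le γ N hT h2ϑ
  have hHc : Continuous (P.hamiltonian N) := pinnedChain_continuous_hamiltonian ω₂ lam β γ N
  -- the corrector propagated for time `t`, as a function of the starting point, is strongly measurable
  have hcm : ∀ t : ℝ, StronglyMeasurable fun z => corrAct ω₂ lam β γ T N ⟨0, hN⟩ t z := fun t => by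
    unfold corrAct
    exact h0m.integral_kernel (κ := P.transitionKernel N T T t.toNNReal)
  -- the dominant
  set G : PhaseSpace N → ℝ := fun z => ‖h0 (z.1, -z.2)‖ * (M * Real.exp (1 / (4 * T) * P.hamiltonian N z)) with hG
  have hGi : Integrable G μT := by
    have hEm : AEStronglyMeasurable (fun z => M * Real.exp (1 / (4 * T) * P.hamiltonian N z)) μT :=
      (continuous_const.mul (Real.continuous_exp.comp (continuous_const.mul hHc))).aestronglyMeasurable
    refine ((h02'.add (hν.const_mul (M ^ 2))).div_const 2).mono' (h0m'.aestronglyMeasurable.norm.mul hEm)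
      (Eventually.of_forall fun z => ?_)
    have hE2 : Real.exp (2 * (1 / (4 * T)) * P.hamiltonian N z) = Real.exp (1 / (4 * T) * P.hamiltonian N z) ^ 2 := by
      rw [← Real.exp_nat_mul]; ring_nf
    rw [Real.norm_eq_abs, abs_of_nonneg (mul_nonneg (norm_nonneg _) (by positivity)), Real.norm_eq_abs, Pi.add_apply,
      hE2]
    nlinarith [sq_nonneg (|h0 (z.1, -z.2)| - M * Real.exp (1 / (4 * T) * P.hamiltonian N z)), sq_abs (h0 (z.1, -z.2))]
  -- dominated convergence: `∫ h₀∘Θ · P_t h₀ dμ_T → 0`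
  have hDCT : Tendsto (fun t : ℝ => ∫ z, h0 (z.1, -z.2) * corrAct ω₂ lam β γ T N ⟨0, hN⟩ t z ∂μT) atTop (𝓝 0) := by
    have h := tendsto_integral_filter_of_dominated_convergence (μ := μT) (l := atTop)
      (F := fun (t : ℝ) (z : PhaseSpace N) => h0 (z.1, -z.2) * corrAct ω₂ lam β γ T N ⟨0, hN⟩ t z)
      (f := fun _ => (0 : ℝ)) G
      (Eventually.of_forall fun t => (h0m'.aestronglyMeasurable.mul (hcm t).aestronglyMeasurable))
      (by
        filter_upwards [eventually_ge_atTop (0 : ℝ)] with t ht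
        refine Eventually.of_forall fun z => ?_
        rw [norm_mul]
        refine mul_le_mul_of_nonneg_left ?_ (norm_nonneg _)
        rw [Real.norm_eq_abs]
        exact abs_corrAct_le hω hl.le hβ hγ hN hT hϑ0 h2ϑ hK.le hb hc ⟨0, hN⟩ ht z)
      hGi
      (Eventually.of_forall fun z => by
        simpa using (tendsto_const_nhds (x := h0 (z.1, -z.2))).mul
          (tendsto_corrAct_atTop hω hl.le hβ hγ hN hT hϑ0 h2ϑ hK.le hb hc ⟨0, hN⟩ z))
    simpa using h
  -- assemble with the pairing formula
  have i1 : Integrable (fun z : PhaseSpace N => h0 (z.1, -z.2) * h0 z) μT :=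
    integrable_mul_of_integrable_sq h0m'.aestronglyMeasurable h0m.aestronglyMeasurable h02' h02
  have iF : ∀ t : ℝ, 0 ≤ t → Integrable (fun z => h0 (z.1, -z.2) * corrAct ω₂ lam β γ T N ⟨0, hN⟩ t z) μT :=
    fun t ht => hGi.mono' (h0m'.aestronglyMeasurable.mul (hcm t).aestronglyMeasurable)
      (Eventually.of_forall fun z => by
        rw [norm_mul]
        refine mul_le_mul_of_nonneg_left ?_ (norm_nonneg _)
        rw [Real.norm_eq_abs]
        exact abs_corrAct_le hω hl.le hβ hγ hN hT hϑ0 h2ϑ hK.le hb hc ⟨0, hN⟩ ht z)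
  have h3 : Tendsto (fun t : ℝ => γ / T ^ 2 * ((∫ z, h0 (z.1, -z.2) * h0 z ∂μT) -
      ∫ z, h0 (z.1, -z.2) * corrAct ω₂ lam β γ T N ⟨0, hN⟩ t z ∂μT)) atTop
      (𝓝 (γ / T ^ 2 * ((∫ z, h0 (z.1, -z.2) * h0 z ∂μT) - 0))) :=
    (tendsto_const_nhds.sub hDCT).const_mul _
  rw [sub_zero] at h3
  refine h3.congr' ?_
  filter_upwards [eventually_ge_atTop (0 : ℝ)] with t ht
  rw [escapeTransient_eq_pairing hω hl hβ hγ hN hT ht, ← integral_sub i1 (iF t ht)]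
  refine congrArg _ (integral_congr_ae (Eventually.of_forall fun z => ?_))
  ring

/-- ★ **SUM RULE, parity form: `lim_{t→∞} Ov_N(t) = (γ/T²)·(‖h₀‖² − ½·oddDefect(μ_T) h₀)`.** [folklore] -/
theorem tendsto_escapeTransient_atTop' (hω : 0 < ω₂) (hl : 0 < lam) (hβ : 0 < β) (hγ : 0 < γ) (hN : 0 < N) (hT : 0 < T) :
    Tendsto (escapeTransient ω₂ lam β γ T N) atTop
      (𝓝 (γ / T ^ 2 * ((∫ z, kinCorrector ω₂ lam β γ T N ⟨0, hN⟩ z ^ 2 ∂((pinnedChain ω₂ lam β γ).gibbsMeasure N T)) -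
        oddDefect ((pinnedChain ω₂ lam β γ).gibbsMeasure N T) (kinCorrector ω₂ lam β γ T N ⟨0, hN⟩) / 2))) := by
  obtain ⟨h0m, h02, -, -⟩ := corrector_sq_facts hω hl.le hβ hγ hN hT ⟨0, hN⟩
  rw [← integral_flip_mul_eq (pinnedChain ω₂ lam β γ) N T h0m h02]
  exact tendsto_escapeTransient_atTop hω hl hβ hγ hN hT

/-- **The even-sector scalar is bounded by the transient ceiling**: if `Ov_N(t) ≤ B` for all `t ≥ 0` then
`(γ/T²)·⟨h₀∘Θ, h₀⟩ ≤ B`. [formal bookkeeping] -/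
theorem flip_pairing_le_of_transient_le (hω : 0 < ω₂) (hl : 0 < lam) (hβ : 0 < β) (hγ : 0 < γ) (hN : 0 < N)
    (hT : 0 < T) {B : ℝ} (hB : ∀ t : ℝ, 0 ≤ t → escapeTransient ω₂ lam β γ T N t ≤ B) :
    γ / T ^ 2 * ∫ z, kinCorrector ω₂ lam β γ T N ⟨0, hN⟩ (z.1, -z.2) * kinCorrector ω₂ lam β γ T N ⟨0, hN⟩ z
        ∂((pinnedChain ω₂ lam β γ).gibbsMeasure N T) ≤ B :=
  le_of_tendsto (tendsto_escapeTransient_atTop hω hl hβ hγ hN hT)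
    ((eventually_ge_atTop (0 : ℝ)).mono fun t ht => hB t ht)

end ParitySectorSplit

end Summit.AtomisticToContinuum.FouriersLaw.Theorems.BoundedResponse.ParityFloor

end
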